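import Summits.QuantumFields.YangMills.Theses.BalabanUVNodes
import Summits.QuantumFields.YangMills.Theorems.BalabanUVNodesK2AxHolds

/-!
# `SpineGivenEndpoint` ⟨stmt-QuantumFields-19182⟩ — LINE-FIRST SKELETON `spine_given_endpoint` (line-writer seat `linewriter-ym-nodeo-1` g0, operator priority28, 2026-08-31)
# route `route-QuantumFields-BalabanUVNodes` (rev 38) · aside (rank 3; rev-0 Stage-0 text; HOLD E1 «misstated at Stage 0 — junk-provable» ✓p409380 ∕ ✓p409394)

THE ITEM AS THE ROUTE READS IT.  `SpineGivenEndpoint F`: from SOME Stage-0 datum of record with (B) and endpoint existence, produce SOME Stage-0 datum of record `D` with (B), endpoint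
existence ([I] Thm 2 p.259, endpoint half) AND the matching spine `T4ApexHybrid.HybridNE7Under D (EndpointExistence D.C.toB12)` ([III]∕[IV]∕[V]'s (E2)–(E7) read along the tuned runs).
AS TYPED junk-closable by the flat Stage-0 witness (hold E1); its CONTENT lives at the live pin — the σ∕choice-free («Ax») Stage-13 record of K0ᴬ ⟨27238⟩ ∕ K1ᴬ ⟨27239⟩ ∕ K3ᴬ ⟨27247⟩
(K2ᴬ ⟨27246⟩ CLOSED·proved: `BalabanUVNodesK2AxHolds.endpointGivenRunRowsR13SepCoPHVAx_holds`).  This skeleton is the NON-VACUOUS road: the datum is THE DATUM OF RECORD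
`Node00.datumOfRecord₁₃SepCoPHVAx F 2 θ h v` of an admissible Stage-13 tuple (K0ᴬ by name — OPEN route item, admissible hypothesis), Stage-0 face `rfl`
(`Node00.isDatumOfRecord₀_datumOfRecord₁₃SepCoPHVAx`, the face the route's `closes` uses), and (B) ∧ endpoint ∧ spine come from ONE registered stub «(B), endpoint existence and
the hybrid spine at SOME admissible Ax record» = this item's content re-pinned at the live record, in K1ᴬ's `∃ θ h v` currency.  The stub is a PROPER WEAKENING of the live cone
(kernel certificate `stub_of_K1Ax_K3Ax`: K1ᴬ's rows + window give the endpoint by K2ᴬ ✓, K3ᴬ gives the spine at that `(θ, h, v)`), so closing K1ᴬ ∧ K3ᴬ closes it by three lines,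
and a road to the spine at ONE admissible version `v` (instead of K3ᴬ's EVERY `(θ, h, v)`) closes this item before K3ᴬ.  The item's own hypothesis (some Stage-0 datum with
(B) ∧ endpoint) is NOT used — at Stage 0 it carries no information (flat witness).
Also in tree, NOT used (ex falso): `BalabanLadderUVNodesRecord11.spineGivenEndpoint_of_nodes (h0 : Record11Inhabited) (h1 : StabilityBAtRecordR11e) …` (jointly unsatisfiable
hypotheses, `…Negative.StabilityBAtRecordR11e_false_of_Record11Inhabited`).

ONE `sorry` (the stub); theorems concluding the crux BY NAME: `SpineGivenEndpoint_of` (K0ᴬ by name + the stub by its registration name), `spineGivenEndpoint_of_axCone` (K0ᴬ only),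
`spineGivenEndpoint_of_K0Ax_K1Ax_K3Ax` (the live cone, no stub, no sorry).  HONEST LABEL: supply for hands, not progress; the item stays an ASIDE on hold; nothing of Bałaban
proved; NODE O not advanced; `closes` reaches only the CONDITIONAL finite-𝕋⁴ rung `BalabanLadder.UV` (R4) at fixed ε; NOT ℝ⁴ ∕ OS ∕ Clay — the Yang–Mills mass gap is NOT proved by
any of this.  [I] = Balaban1987RG1 Thm 2 p.259; [III] = Balaban1988Convergent Thm 1 p.262; [V] = Balaban1989LargeFieldII Thm 1 p.355.
-/

open Literature.MathematicalPhysics.QuantumFieldTheory.Balaban1983to89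
open Literature.MathematicalPhysics.QuantumFieldTheory.Balaban1983to89.T4Continuum

namespace Summit.QuantumFields.YangMills.Theses.BalabanUVNodes.SpineGivenEndpointSkeletonV1

/-! ## §1. The registered stub: (B) ∧ endpoint ∧ hybrid spine at SOME admissible Ax record -/

/-- **stub — (B), endpoint existence and the hybrid (E2)–(E7) spine at some admissible σ∕choice-free Stage-13 record (with some version `v`) of every family that has an admissible
tuple.**  PRINT: [V] Thm 1 ((B)); [I] Thm 2 p.259 (endpoint — in tree from the run rows, K2ᴬ ✓); [III] Thm 1 p.262 + [IV]∕[V] ((E2)–(E7) along tuned runs = K3ᴬ's content,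
`T4ApexHybrid.HybridNE7Under`).  Weaker than K1ᴬ ∧ K3ᴬ (`stub_of_K1Ax_K3Ax`): ∃ over `(θ, h, v)` instead of K3ᴬ's ∀, and no run rows ∕ window displayed.  Size L. -/
theorem stub_spineBEndpointAtSomeAxRecord :
    ∀ F : T4Family, (∃ θ : Node00.Stage13HParams F 2, θ.Provisos₁₃SepCoPHAx F 2 ∧ (θ.ZhUnity F 2 ∧ θ.SlotsNondegenerate₁₃Ax F 2) ∧ θ.Admissible F 2) →
      ∃ (θ : Node00.Stage13HParams F 2) (h : θ.Provisos₁₃SepCoPHAx F 2) (v : Node00.Revision₁₃Ax F 2 θ h),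
        (θ.ZhUnity F 2 ∧ θ.SlotsNondegenerate₁₃Ax F 2) ∧ θ.Admissible F 2 ∧
        B16.EndStatementBPrinted (Node00.datumOfRecord₁₃SepCoPHVAx F 2 θ h v).C ∧
        DagBinding.EndpointExistence (Node00.datumOfRecord₁₃SepCoPHVAx F 2 θ h v).C.toB12 ∧
        T4ApexHybrid.HybridNE7Under (Node00.datumOfRecord₁₃SepCoPHVAx F 2 θ h v)
          (DagBinding.EndpointExistence (Node00.datumOfRecord₁₃SepCoPHVAx F 2 θ h v).C.toB12) := by
  sorry

/-- Registration name of the stub (statement verbatim as a reducible abbreviation NAMED LIKE THE STUB; makes `SpineGivenEndpoint_of`'s second binder admissible for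
`#h21_check_skeleton` rule (ii)). -/
abbrev Registered.stub_spineBEndpointAtSomeAxRecord : Prop :=
  ∀ F : T4Family, (∃ θ : Node00.Stage13HParams F 2, θ.Provisos₁₃SepCoPHAx F 2 ∧ (θ.ZhUnity F 2 ∧ θ.SlotsNondegenerate₁₃Ax F 2) ∧ θ.Admissible F 2) →
      ∃ (θ : Node00.Stage13HParams F 2) (h : θ.Provisos₁₃SepCoPHAx F 2) (v : Node00.Revision₁₃Ax F 2 θ h),
        (θ.ZhUnity F 2 ∧ θ.SlotsNondegenerate₁₃Ax F 2) ∧ θ.Admissible F 2 ∧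
        B16.EndStatementBPrinted (Node00.datumOfRecord₁₃SepCoPHVAx F 2 θ h v).C ∧
        DagBinding.EndpointExistence (Node00.datumOfRecord₁₃SepCoPHVAx F 2 θ h v).C.toB12 ∧
        T4ApexHybrid.HybridNE7Under (Node00.datumOfRecord₁₃SepCoPHVAx F 2 θ h v)
          (DagBinding.EndpointExistence (Node00.datumOfRecord₁₃SepCoPHVAx F 2 θ h v).C.toB12)

/-! ## §2. Kernel certificate: the stub is implied by the live cone K1ᴬ ∧ K3ᴬ (K2ᴬ ✓ in tree) -/

/-- **WEAKER THAN THE LIVE CONE** (kernel, no sorry): K1ᴬ ⟨27239⟩ and K3ᴬ ⟨27247⟩ imply the stub — K1ᴬ's (B), run rows and window give the endpoint by the CLOSED K2ᴬ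
(`BalabanUVNodesK2AxHolds.endpointGivenRunRowsR13SepCoPHVAx_holds`), K3ᴬ the spine at the same `(θ, h, v)`. -/
theorem stub_of_K1Ax_K3Ax (h1 : Summit.QuantumFields.YangMills.Theses.BalabanUVNodes.StabilityBRunRowsAtRecordR13SepCoPHVAx)
    (h3 : Summit.QuantumFields.YangMills.Theses.BalabanUVNodes.SpineGivenEndpointR13SepCoPHVAx) :
    Registered.stub_spineBEndpointAtSomeAxRecord := by
  intro F hF
  obtain ⟨θ, h, v, hU, hθ, hb, hwin, hrows⟩ := h1 F hF
  have hend : DagBinding.EndpointExistence (Node00.datumOfRecord₁₃SepCoPHVAx F 2 θ h v).C.toB12 :=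
    Summit.QuantumFields.YangMills.Theorems.BalabanUVNodesK2AxHolds.endpointGivenRunRowsR13SepCoPHVAx_holds F θ h v hU hθ hb hrows hwin
  exact ⟨θ, h, v, hU, hθ, hb, hend, h3 F θ h v hU hθ hb hend⟩

/-! ## §3. Composition BY NAME -/

/-- **★ `SpineGivenEndpoint` from K0ᴬ (by name) and the stub (by its registration name).**  The item's Stage-0 hypothesis is discarded (it carries no information at Stage 0);
the datum is the Ax datum of record, Stage-0 face `Node00.isDatumOfRecord₀_datumOfRecord₁₃SepCoPHVAx` (`rfl`).  No `sorry` here. -/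
theorem SpineGivenEndpoint_of (h0 : Summit.QuantumFields.YangMills.Theses.BalabanUVNodes.Record13SepCoPHInhabitedAx)
    (hS : Registered.stub_spineBEndpointAtSomeAxRecord) :
    Summit.QuantumFields.YangMills.Theses.BalabanUVNodes.SpineGivenEndpoint := by
  intro F _
  obtain ⟨θ, h, v, -, -, hb, hend, hspine⟩ := hS F (h0 F)
  exact ⟨Node00.datumOfRecord₁₃SepCoPHVAx F 2 θ h v, Node00.isDatumOfRecord₀_datumOfRecord₁₃SepCoPHVAx F 2 θ h v, hb, hend, hspine⟩

/-- **★ THE SKELETON THEOREM — `SpineGivenEndpoint` from the live cone's K0ᴬ ⟨27238⟩ (OPEN route item, by name) and the ONE registered stub.** -/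
theorem spineGivenEndpoint_of_axCone (h0 : Summit.QuantumFields.YangMills.Theses.BalabanUVNodes.Record13SepCoPHInhabitedAx) :
    Summit.QuantumFields.YangMills.Theses.BalabanUVNodes.SpineGivenEndpoint :=
  SpineGivenEndpoint_of h0 stub_spineBEndpointAtSomeAxRecord

/-- Corollary (kernel, no sorry): the live cone K0ᴬ ∧ K1ᴬ ∧ K3ᴬ (with K2ᴬ ✓) already implies this aside — nothing separate is ever needed for ⟨19182⟩ once ⟨27238⟩∕⟨27239⟩∕⟨27247⟩ close. -/
theorem spineGivenEndpoint_of_K0Ax_K1Ax_K3Ax (h0 : Summit.QuantumFields.YangMills.Theses.BalabanUVNodes.Record13SepCoPHInhabitedAx)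
    (h1 : Summit.QuantumFields.YangMills.Theses.BalabanUVNodes.StabilityBRunRowsAtRecordR13SepCoPHVAx)
    (h3 : Summit.QuantumFields.YangMills.Theses.BalabanUVNodes.SpineGivenEndpointR13SepCoPHVAx) :
    Summit.QuantumFields.YangMills.Theses.BalabanUVNodes.SpineGivenEndpoint :=
  SpineGivenEndpoint_of h0 (stub_of_K1Ax_K3Ax h1 h3)

end Summit.QuantumFields.YangMills.Theses.BalabanUVNodes.SpineGivenEndpointSkeletonV1
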